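import Mathlib
import Literature.NumberTheory.LFunctions.KlurmanMangerelTeravainenShortAPs
import Summits.QuantumAdvantage.QuantumAdvantage.Theorems.MobiusLadderDigitPolyUniformityKMTOddScale
import Summits.QuantumAdvantage.QuantumAdvantage.Theorems.MobiusLadderDigitPolyUniformityKMTDyadic
import Summits.QuantumAdvantage.QuantumAdvantage.Theorems.MobiusLadderLiouvilleNotTC0
import HarnessLib

/-!
# Crux `DigitPolyUniformity` (stmt-QuantumAdvantage-1392), line `Sketch` — cycle 7 (seat c6):
# odd residue classes in aligned blocks, all scales (assembly of `kmt_oddAP_scale_le`)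

Registered lead stub `liouville_oddAP_blocks_le` of the KLURMAN–MANGEREL–TERÄVÄINEN CLASS
(`Cruxes/DigitPolyUniformity/Lines/SketchLAR.lean`, §Cycle 7).  For every `δ > 0` there is `L` such that for all
`n, k ≥ 1, h` with `k + L ≤ h ≤ n − L` and `L k² + L ≤ n`:
`Σ_{y<2^{n−h}} Σ_{a<2^k odd} |Σ_{N∈[2^h y, 2^h y+2^h), N≡a (2^k)} λ(N)| ≤ δ2ⁿ`.
Proof: split the block index `y` dyadically (`stub_kmt_dyadic`); the block `y = 0` and the scales `i < L₀k²` are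
bounded trivially (a family of residue-class sums over a set `S` of integers totals at most `#S` in absolute value),
the scales `i ≥ L₀k²` by `kmt_oddAP_scale_le` with the parameters `τ` (`2^τ ≥ 16/δ`), `ε₁` (`2^τ A√ε₁ ≤ δ/8`) and
the threshold making `2^τ K' e^{−c₂√(i log 2)} ≤ δ/8`; the geometric sums close the estimate.
CONDITIONAL on the KMT named fact (hypothesis `hKMT`), and on nothing else.
-/

noncomputable section

namespace Summit.QuantumAdvantage.DigitPolyUniformity.SketchLAR.KMT

open Finset
open Literature.NumberTheory.LFunctions

namespace Blocks

/-- A family of residue-class sums of a 1-bounded sequence over a finite set `S` of integers totals at most `#S` in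
absolute value: `Σ_{a ∈ T} |Σ_{N ∈ S, N ≡ a (q)} c(N)| ≤ #S` for `T ⊆ [0, q)`, `q ≥ 1`. [folklore] -/
theorem sum_abs_classSum_le_card (S T : Finset ℕ) {q : ℕ} (hq : 0 < q) (hT : T ⊆ range q) (c : ℕ → ℝ)
    (hc : ∀ n, |c n| ≤ 1) :
    ∑ a ∈ T, |∑ N ∈ S.filter (fun N => N % q = a), c N| ≤ S.card := by
  have hfib : (S.card : ℝ) = ∑ a ∈ range q, ((S.filter (fun N => N % q = a)).card : ℝ) := by
    have := Finset.card_eq_sum_card_fiberwise (s := S) (t := range q) (f := fun N => N % q)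
      (fun N _ => Finset.mem_range.2 (Nat.mod_lt N hq))
    exact_mod_cast this
  rw [hfib]
  calc ∑ a ∈ T, |∑ N ∈ S.filter (fun N => N % q = a), c N|
      ≤ ∑ a ∈ T, ((S.filter (fun N => N % q = a)).card : ℝ) := by
        refine Finset.sum_le_sum fun a _ => ?_
        calc |∑ N ∈ S.filter (fun N => N % q = a), c N|
            ≤ ∑ N ∈ S.filter (fun N => N % q = a), |c N| := Finset.abs_sum_le_sum_abs _ _
          _ ≤ ∑ _N ∈ S.filter (fun N => N % q = a), (1 : ℝ) := Finset.sum_le_sum fun N _ => hc N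
          _ = _ := by rw [Finset.sum_const, nsmul_eq_mul, mul_one]
    _ ≤ ∑ a ∈ range q, ((S.filter (fun N => N % q = a)).card : ℝ) :=
        Finset.sum_le_sum_of_subset_of_nonneg hT fun a _ _ => by positivity

/-- The odd-residue block sums at block `y` total at most the block length `2^h`. [folklore] -/
theorem oddBlock_le (k h y : ℕ) :
    ∑ a ∈ (range (2 ^ k)).filter (fun a => Odd a),
        |∑ N ∈ (Ico (2 ^ h * y) (2 ^ h * y + 2 ^ h)).filter (fun N => N % 2 ^ k = a),
          ((ArithmeticFunction.liouville N : ℤ) : ℝ)| ≤ (2 : ℝ) ^ h := by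
  have := sum_abs_classSum_le_card (Ico (2 ^ h * y) (2 ^ h * y + 2 ^ h)) ((range (2 ^ k)).filter (fun a => Odd a))
    (Nat.two_pow_pos k) (Finset.filter_subset _ _) (fun N => ((ArithmeticFunction.liouville N : ℤ) : ℝ))
    Summit.QuantumAdvantage.QuantumAdvantage.Theorems.MobiusLadder.abs_cast_liouville_le_one
  rw [Nat.card_Ico, Nat.add_sub_cancel_left] at this
  exact_mod_cast this

end Blocks

open Blocks

/-- **Core of `liouville_oddAP_blocks_le`.** Given the per-scale bound (`hscale`, the conclusion of
`kmt_oddAP_scale_le` for fixed constants `A, c₂, K'`) and parameters `δ, ε₁, τ, i₁, i₀` with the four smallness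
conditions (`2^τ A√ε₁ ≤ δ/8`, `2^τ K' e^{−c₂√(i log 2)} ≤ δ/8` for `i ≥ i₁`, `2 ≤ (δ/8)2^τ`, `16 ≤ 2^τδ`) and the
admissibility of `(n, k, h)`, the odd-residue block sums total `≤ δ2ⁿ`: dyadic decomposition (`stub_kmt_dyadic`), the
trivial bound `2^i` at scales `i < i₀` and for the block `y = 0`, the per-scale bound `2^i·δ/2` at scales `i ≥ i₀`,
geometric sums. [folklore] -/
theorem oddAP_blocks_core {A c₂ K' δ ε₁ : ℝ} {τ i₁ i₀ n k h : ℕ}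
    (hscale : ∀ i : ℕ, h ≤ i → (k : ℝ) ≤ ε₁ ^ (200 : ℕ) * i → (k : ℝ) ^ 2 * Real.log 2 ≤ c₂ ^ 2 * i →
      ∑ y ∈ Ico (2 ^ (i - h)) (2 ^ (i + 1 - h)), ∑ a ∈ (range (2 ^ k)).filter (fun a => Odd a),
        |∑ N ∈ (Ico (2 ^ h * y) (2 ^ h * y + 2 ^ h)).filter (fun N => N % 2 ^ k = a),
          ((ArithmeticFunction.liouville N : ℤ) : ℝ)| ≤
        (2 : ℝ) ^ i * (2 ^ τ * (A * Real.sqrt ε₁ + K' * Real.exp (-(c₂ * Real.sqrt (i * Real.log 2)))) +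
          2 / 2 ^ τ + 2 * 2 ^ k / 2 ^ h))
    (hδ : 0 < δ) (hAterm : (2 : ℝ) ^ τ * (A * Real.sqrt ε₁) ≤ δ / 8)
    (hKterm : ∀ i : ℕ, i₁ ≤ i → (2 : ℝ) ^ τ * (K' * Real.exp (-(c₂ * Real.sqrt (i * Real.log 2)))) ≤ δ / 8)
    (hδτ2 : (2 : ℝ) ≤ δ / 8 * 2 ^ τ) (hτδ : (16 : ℝ) ≤ 2 ^ τ * δ)
    (hkh : k ≤ h) (hτhk : τ ≤ h - k)
    (hgood_ε : ∀ i : ℕ, i₀ ≤ i → (k : ℝ) ≤ ε₁ ^ (200 : ℕ) * i)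
    (hgood_c : ∀ i : ℕ, i₀ ≤ i → (k : ℝ) ^ 2 * Real.log 2 ≤ c₂ ^ 2 * i)
    (hi₁i₀ : i₁ ≤ i₀) (hi₀n : i₀ + τ ≤ n) (hhn : h + τ ≤ n) :
    ∑ y ∈ range (2 ^ (n - h)), ∑ a ∈ (range (2 ^ k)).filter (fun a => Odd a),
        |∑ N ∈ (Ico (2 ^ h * y) (2 ^ h * y + 2 ^ h)).filter (fun N => N % 2 ^ k = a),
          ((ArithmeticFunction.liouville N : ℤ) : ℝ)| ≤ δ * 2 ^ n := by
  have h2τ : (0 : ℝ) < 2 ^ τ := by positivity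
  have hδτ : 2 / (2 : ℝ) ^ τ ≤ δ / 8 := by rw [div_le_iff₀ h2τ]; exact hδτ2
  -- the per-scale bound at good scales
  have hgood : ∀ i ∈ (Ico h n).filter (fun i => i₀ ≤ i),
      ∑ y ∈ Ico (2 ^ (i - h)) (2 ^ (i + 1 - h)), ∑ a ∈ (range (2 ^ k)).filter (fun a => Odd a),
        |∑ N ∈ (Ico (2 ^ h * y) (2 ^ h * y + 2 ^ h)).filter (fun N => N % 2 ^ k = a),
          ((ArithmeticFunction.liouville N : ℤ) : ℝ)| ≤ (2 : ℝ) ^ i * (δ / 2) := by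
    intro i hi
    rw [Finset.mem_filter, Finset.mem_Ico] at hi
    obtain ⟨⟨hhi, _⟩, hi0⟩ := hi
    refine (hscale i hhi (hgood_ε i hi0) (hgood_c i hi0)).trans ?_
    have h2i : (0 : ℝ) < 2 ^ i := by positivity
    refine mul_le_mul_of_nonneg_left ?_ h2i.le
    have hK := hKterm i (hi₁i₀.trans hi0)
    have hkhR : 2 * (2 : ℝ) ^ k / 2 ^ h ≤ δ / 8 := by
      have h2hk : (2 : ℝ) ^ h = 2 ^ (h - k) * 2 ^ k := by rw [← pow_add, Nat.sub_add_cancel hkh]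
      have hτhk' : (2 : ℝ) ^ τ ≤ 2 ^ (h - k) := pow_le_pow_right₀ (by norm_num) hτhk
      have h2k : (0 : ℝ) < 2 ^ k := by positivity
      rw [div_le_iff₀ (by positivity : (0 : ℝ) < 2 ^ h), h2hk]
      calc 2 * (2 : ℝ) ^ k ≤ (δ / 8 * 2 ^ τ) * 2 ^ k := mul_le_mul_of_nonneg_right hδτ2 h2k.le
        _ ≤ (δ / 8 * 2 ^ (h - k)) * 2 ^ k := by gcongr
        _ = δ / 8 * (2 ^ (h - k) * 2 ^ k) := by ring
    have e1 : (2 : ℝ) ^ τ * (A * Real.sqrt ε₁ + K' * Real.exp (-(c₂ * Real.sqrt (i * Real.log 2)))) =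
        2 ^ τ * (A * Real.sqrt ε₁) + 2 ^ τ * (K' * Real.exp (-(c₂ * Real.sqrt (i * Real.log 2)))) :=
      mul_add _ _ _
    rw [e1]
    linarith only [hAterm, hK, hδτ, hkhR]
  -- trivial bound at every scale
  have htriv : ∀ i ∈ Ico h n,
      ∑ y ∈ Ico (2 ^ (i - h)) (2 ^ (i + 1 - h)), ∑ a ∈ (range (2 ^ k)).filter (fun a => Odd a),
        |∑ N ∈ (Ico (2 ^ h * y) (2 ^ h * y + 2 ^ h)).filter (fun N => N % 2 ^ k = a),
          ((ArithmeticFunction.liouville N : ℤ) : ℝ)| ≤ (2 : ℝ) ^ i := by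
    intro i hi
    rw [Finset.mem_Ico] at hi
    calc _ ≤ ∑ _y ∈ Ico (2 ^ (i - h)) (2 ^ (i + 1 - h)), (2 : ℝ) ^ h :=
          Finset.sum_le_sum fun y _ => oddBlock_le k h y
      _ = (2 : ℝ) ^ i := by
          rw [Finset.sum_const, Nat.card_Ico, nsmul_eq_mul, show i + 1 - h = (i - h) + 1 by omega, pow_succ,
            show 2 ^ (i - h) * 2 - 2 ^ (i - h) = 2 ^ (i - h) by omega]
          push_cast
          rw [← pow_add, Nat.sub_add_cancel hi.1]
  -- assembly
  rw [stub_kmt_dyadic _ h n]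
  have hsplit := (Finset.sum_filter_add_sum_filter_not (Ico h n) (fun i => i₀ ≤ i)
    (fun i => ∑ y ∈ Ico (2 ^ (i - h)) (2 ^ (i + 1 - h)), ∑ a ∈ (range (2 ^ k)).filter (fun a => Odd a),
      |∑ N ∈ (Ico (2 ^ h * y) (2 ^ h * y + 2 ^ h)).filter (fun N => N % 2 ^ k = a),
        ((ArithmeticFunction.liouville N : ℤ) : ℝ)|)).symm
  rw [hsplit]
  -- the three pieces
  have hpow_le : ∀ m : ℕ, m + τ ≤ n → (2 : ℝ) ^ m ≤ δ / 16 * 2 ^ n := by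
    intro m hm
    have hmn : (2 : ℝ) ^ m * 2 ^ τ ≤ 2 ^ n := by
      rw [← pow_add]; exact pow_le_pow_right₀ (by norm_num) hm
    calc (2 : ℝ) ^ m = 2 ^ m * 1 := (mul_one _).symm
      _ ≤ 2 ^ m * (2 ^ τ * δ / 16) := by
          refine mul_le_mul_of_nonneg_left ?_ (by positivity)
          rw [le_div_iff₀ (by norm_num)]; linarith only [hτδ]
      _ = δ / 16 * (2 ^ m * 2 ^ τ) := by ring
      _ ≤ δ / 16 * 2 ^ n := by gcongr
  have hP0 : ∑ a ∈ (range (2 ^ k)).filter (fun a => Odd a),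
      |∑ N ∈ (Ico (2 ^ h * 0) (2 ^ h * 0 + 2 ^ h)).filter (fun N => N % 2 ^ k = a),
        ((ArithmeticFunction.liouville N : ℤ) : ℝ)| ≤ δ / 16 * 2 ^ n :=
    (oddBlock_le k h 0).trans (hpow_le h (by omega))
  have hPgood : ∑ i ∈ (Ico h n).filter (fun i => i₀ ≤ i),
      ∑ y ∈ Ico (2 ^ (i - h)) (2 ^ (i + 1 - h)), ∑ a ∈ (range (2 ^ k)).filter (fun a => Odd a),
        |∑ N ∈ (Ico (2 ^ h * y) (2 ^ h * y + 2 ^ h)).filter (fun N => N % 2 ^ k = a),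
          ((ArithmeticFunction.liouville N : ℤ) : ℝ)| ≤ δ / 2 * 2 ^ n := by
    calc _ ≤ ∑ i ∈ (Ico h n).filter (fun i => i₀ ≤ i), (2 : ℝ) ^ i * (δ / 2) := Finset.sum_le_sum hgood
      _ ≤ ∑ i ∈ range n, (2 : ℝ) ^ i * (δ / 2) := by
          refine Finset.sum_le_sum_of_subset_of_nonneg ?_ fun i _ _ => by positivity
          intro i hi
          rw [Finset.mem_filter, Finset.mem_Ico] at hi
          exact Finset.mem_range.2 hi.1.2
      _ = (∑ i ∈ range n, (2 : ℝ) ^ i) * (δ / 2) := by rw [Finset.sum_mul]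
      _ ≤ 2 ^ n * (δ / 2) := by
          gcongr
          rw [geom_sum_eq (by norm_num) n]; norm_num
      _ = δ / 2 * 2 ^ n := by ring
  have hPtriv : ∑ i ∈ (Ico h n).filter (fun i => ¬ i₀ ≤ i),
      ∑ y ∈ Ico (2 ^ (i - h)) (2 ^ (i + 1 - h)), ∑ a ∈ (range (2 ^ k)).filter (fun a => Odd a),
        |∑ N ∈ (Ico (2 ^ h * y) (2 ^ h * y + 2 ^ h)).filter (fun N => N % 2 ^ k = a),
          ((ArithmeticFunction.liouville N : ℤ) : ℝ)| ≤ δ / 16 * 2 ^ n := by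
    calc _ ≤ ∑ i ∈ (Ico h n).filter (fun i => ¬ i₀ ≤ i), (2 : ℝ) ^ i :=
          Finset.sum_le_sum fun i hi => htriv i (Finset.mem_filter.1 hi).1
      _ ≤ ∑ i ∈ range i₀, (2 : ℝ) ^ i := by
          refine Finset.sum_le_sum_of_subset_of_nonneg ?_ fun i _ _ => by positivity
          intro i hi
          rw [Finset.mem_filter] at hi
          exact Finset.mem_range.2 (not_le.1 hi.2)
      _ ≤ 2 ^ i₀ := by rw [geom_sum_eq (by norm_num) i₀]; norm_num
      _ ≤ δ / 16 * 2 ^ n := hpow_le i₀ hi₀n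
  have htotal := add_le_add hP0 (add_le_add hPgood hPtriv)
  refine htotal.trans (le_of_eq_of_le (by ring : δ / 16 * (2 : ℝ) ^ n + (δ / 2 * 2 ^ n + δ / 16 * 2 ^ n) =
    (5 / 8) * (δ * 2 ^ n)) ?_)
  have h0 : 0 ≤ δ * (2 : ℝ) ^ n := by positivity
  linarith only [h0]

set_option maxHeartbeats 400000 in
/-- **Odd residue classes in aligned blocks (lead; CONDITIONAL on the KMT named fact).** For every `δ > 0` there is
`L` such that for all `n, k ≥ 1, h` with `k + L ≤ h ≤ n − L` and `L k² + L ≤ n`: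
`Σ_{y<2^{n−h}} Σ_{a<2^k odd} |Σ_{N∈[2^h y, 2^h y+2^h), N≡a (2^k)} λ(N)| ≤ δ2ⁿ`.  Dyadic scales `[2^i, 2^{i+1})`,
`i ≥ L k²`: windows to the right of each block (`stub_kmt_window_average_AP`, `T = 2^{h−τ}`), Cauchy–Schwarz
(`stub_kmt_cauchySchwarz`), the mean square from KMT (`stub_kmt_discretise`) and the main term from
`stub_kmt_mainTerm`; small scales trivially.
[cite: KlurmanMangerelTeravainen2023ShortAPs, Corollary 1.7 and Theorem 1.6] -/
theorem liouville_oddAP_blocks_le (hKMT : KMT2023_corollary17_liouville_twoPower) :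
    ∀ δ : ℝ, 0 < δ → ∃ L : ℕ, ∀ n k h : ℕ, 1 ≤ k → k + L ≤ h → h + L ≤ n → L * k ^ 2 + L ≤ n →
      ∑ y ∈ range (2 ^ (n - h)), ∑ a ∈ (range (2 ^ k)).filter (fun a => Odd a),
        |∑ N ∈ (Ico (2 ^ h * y) (2 ^ h * y + 2 ^ h)).filter (fun N => N % 2 ^ k = a),
          ((ArithmeticFunction.liouville N : ℤ) : ℝ)| ≤ δ * 2 ^ n := by
  obtain ⟨A, hA, c₂, hc₂, K', hK', hscale⟩ := kmt_oddAP_scale_le hKMT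
  intro δ hδ
  have hlog2 : 0 < Real.log 2 := Real.log_pos one_lt_two
  -- τ : 2^τ ≥ 16/δ
  obtain ⟨τ, hτ⟩ : ∃ τ : ℕ, 16 / δ ≤ (2 : ℝ) ^ τ := by
    obtain ⟨τ, hτ⟩ := pow_unbounded_of_one_lt (16 / δ) (one_lt_two (α := ℝ))
    exact ⟨τ, hτ.le⟩
  have h2τ : (0 : ℝ) < 2 ^ τ := by positivity
  have hτδ : (16 : ℝ) ≤ 2 ^ τ * δ := by rwa [div_le_iff₀ hδ] at hτ
  have hδτ2 : (2 : ℝ) ≤ δ / 8 * 2 ^ τ := by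
    rw [show δ / 8 * (2 : ℝ) ^ τ = 2 ^ τ * δ / 8 by ring, le_div_iff₀ (by norm_num)]; linarith
  -- ε₁
  set ρ : ℝ := δ / (8 * 2 ^ τ * (A + 1)) with hρ
  have hρpos : 0 < ρ := by positivity
  set ε₁ : ℝ := min 1 (ρ ^ 2) with hε₁def
  have hε₁pos : 0 < ε₁ := lt_min one_pos (by positivity)
  have hε₁1 : ε₁ ≤ 1 := min_le_left _ _
  have hsqrtε₁ : Real.sqrt ε₁ ≤ ρ := by
    calc Real.sqrt ε₁ ≤ Real.sqrt (ρ ^ 2) := Real.sqrt_le_sqrt (min_le_right _ _)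
      _ = ρ := Real.sqrt_sq hρpos.le
  have hAterm : (2 : ℝ) ^ τ * (A * Real.sqrt ε₁) ≤ δ / 8 := by
    calc (2 : ℝ) ^ τ * (A * Real.sqrt ε₁) ≤ 2 ^ τ * ((A + 1) * ρ) := by gcongr; linarith
      _ = δ / 8 := by rw [hρ]; field_simp
  -- the threshold scale for the main-term decay
  set η₀ : ℝ := δ / (8 * 2 ^ τ * (K' + 1)) with hη₀
  have hη₀pos : 0 < η₀ := by positivity
  set i₁ : ℕ := ⌈(Real.log (1 / η₀) / c₂) ^ 2 / Real.log 2⌉₊ with hi₁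
  have hexp_i₁ : ∀ i : ℕ, i₁ ≤ i → Real.exp (-(c₂ * Real.sqrt (i * Real.log 2))) ≤ η₀ := by
    intro i hi
    have h1 : (Real.log (1 / η₀) / c₂) ^ 2 / Real.log 2 ≤ i :=
      (Nat.le_ceil _).trans (by exact_mod_cast hi)
    have h2 : (Real.log (1 / η₀) / c₂) ^ 2 ≤ i * Real.log 2 := by
      rw [div_le_iff₀ hlog2] at h1; linarith
    have h3 : Real.log (1 / η₀) / c₂ ≤ Real.sqrt (i * Real.log 2) := by
      calc Real.log (1 / η₀) / c₂ ≤ |Real.log (1 / η₀) / c₂| := le_abs_self _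
        _ = Real.sqrt ((Real.log (1 / η₀) / c₂) ^ 2) := (Real.sqrt_sq_eq_abs _).symm
        _ ≤ Real.sqrt (i * Real.log 2) := Real.sqrt_le_sqrt h2
    have h4 : Real.log (1 / η₀) ≤ c₂ * Real.sqrt (i * Real.log 2) := by
      rw [div_le_iff₀ hc₂] at h3; linarith
    rw [Real.log_div (by norm_num) hη₀pos.ne', Real.log_one, zero_sub] at h4
    calc Real.exp (-(c₂ * Real.sqrt (i * Real.log 2))) ≤ Real.exp (Real.log η₀) := by
          rw [Real.exp_le_exp]; linarith
      _ = η₀ := Real.exp_log hη₀pos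
  have hKterm : ∀ i : ℕ, i₁ ≤ i →
      (2 : ℝ) ^ τ * (K' * Real.exp (-(c₂ * Real.sqrt (i * Real.log 2)))) ≤ δ / 8 := by
    intro i hi
    have h1 : K' * Real.exp (-(c₂ * Real.sqrt (i * Real.log 2))) ≤ (K' + 1) * η₀ :=
      mul_le_mul (by linarith) (hexp_i₁ i hi) (Real.exp_pos _).le (by linarith)
    calc (2 : ℝ) ^ τ * (K' * Real.exp (-(c₂ * Real.sqrt (i * Real.log 2))))
        ≤ 2 ^ τ * ((K' + 1) * η₀) := mul_le_mul_of_nonneg_left h1 h2τ.le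
      _ = δ / 8 := by rw [hη₀]; field_simp
  -- the remaining integer constants
  set E : ℕ := ⌈ε₁ ^ (-(200 : ℝ))⌉₊ with hE
  set G : ℕ := ⌈Real.log 2 / c₂ ^ 2⌉₊ with hG
  set L₀ : ℕ := E + G + i₁ + 1 with hL₀
  set W₁ : ℕ := ⌈ε₁ ^ (-(200 : ℝ)) / Real.log 2⌉₊ + 1 with hW₁
  set W₂ : ℕ := ⌈Real.log 541 / (ε₁ ^ 2 * Real.log 2)⌉₊ + 1 with hW₂
  set L : ℕ := L₀ + W₁ + W₂ + τ + 4 with hLdef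
  refine ⟨L, fun n k h hk1 hkL hhL hLk => ?_⟩
  -- derived inequalities
  have hkh4 : k + 4 ≤ h := by omega
  have hτh : τ ≤ h := by omega
  have hhk : W₁ ≤ h - k ∧ W₂ ≤ h - k ∧ τ ≤ h - k := ⟨by omega, by omega, by omega⟩
  set i₀ : ℕ := L₀ * k ^ 2 with hi₀
  have hi₀n : i₀ + τ ≤ n := by
    have : L₀ * k ^ 2 ≤ L * k ^ 2 := Nat.mul_le_mul_right _ (by omega)
    omega
  have hk2 : k ≤ k ^ 2 := by nlinarith
  have hwin : ε₁ ^ (-(200 : ℝ)) ≤ ((h - k : ℕ) : ℝ) * Real.log 2 := by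
    have h1 : ε₁ ^ (-(200 : ℝ)) / Real.log 2 ≤ W₁ := by
      rw [hW₁]; push_cast; linarith [Nat.le_ceil (ε₁ ^ (-(200 : ℝ)) / Real.log 2)]
    have h2 : (W₁ : ℝ) ≤ ((h - k : ℕ) : ℝ) := by exact_mod_cast hhk.1
    rw [div_le_iff₀ hlog2] at h1
    nlinarith
  have htyp : Real.log 541 ≤ ((h - k : ℕ) : ℝ) * ε₁ ^ 2 * Real.log 2 := by
    have hpos : 0 < ε₁ ^ 2 * Real.log 2 := by positivity
    have h1 : Real.log 541 / (ε₁ ^ 2 * Real.log 2) ≤ W₂ := by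
      rw [hW₂]; push_cast; linarith [Nat.le_ceil (Real.log 541 / (ε₁ ^ 2 * Real.log 2))]
    have h2 : (W₂ : ℝ) ≤ ((h - k : ℕ) : ℝ) := by exact_mod_cast hhk.2.1
    rw [div_le_iff₀ hpos] at h1
    nlinarith
  have hgood_ε : ∀ i : ℕ, i₀ ≤ i → (k : ℝ) ≤ ε₁ ^ (200 : ℕ) * i := by
    intro i hi
    have hEk : E * k ≤ i := by
      calc E * k ≤ E * k ^ 2 := Nat.mul_le_mul_left _ hk2
        _ ≤ L₀ * k ^ 2 := Nat.mul_le_mul_right _ (by omega)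
        _ ≤ i := hi
    have hE1 : ε₁ ^ (-(200 : ℝ)) ≤ E := Nat.le_ceil _
    have hεE : (1 : ℝ) ≤ ε₁ ^ (200 : ℕ) * E := by
      have : ε₁ ^ (200 : ℕ) * ε₁ ^ (-(200 : ℝ)) = 1 := by
        rw [← Real.rpow_natCast, ← Real.rpow_add hε₁pos]; norm_num
      calc (1 : ℝ) = ε₁ ^ (200 : ℕ) * ε₁ ^ (-(200 : ℝ)) := this.symm
        _ ≤ ε₁ ^ (200 : ℕ) * E := by gcongr
    have hEkR : ((E * k : ℕ) : ℝ) ≤ i := by exact_mod_cast hEk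
    push_cast at hEkR
    calc (k : ℝ) = 1 * k := (one_mul _).symm
      _ ≤ ε₁ ^ (200 : ℕ) * E * k := by gcongr
      _ = ε₁ ^ (200 : ℕ) * (E * k) := by ring
      _ ≤ ε₁ ^ (200 : ℕ) * i := by gcongr
  have hgood_c : ∀ i : ℕ, i₀ ≤ i → (k : ℝ) ^ 2 * Real.log 2 ≤ c₂ ^ 2 * i := by
    intro i hi
    have hGk : G * k ^ 2 ≤ i := (Nat.mul_le_mul_right _ (by omega)).trans hi
    have hG1 : Real.log 2 / c₂ ^ 2 ≤ G := Nat.le_ceil _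
    have hc2 : (0 : ℝ) < c₂ ^ 2 := by positivity
    rw [div_le_iff₀ hc2] at hG1
    have hGkR : ((G * k ^ 2 : ℕ) : ℝ) ≤ i := by exact_mod_cast hGk
    push_cast at hGkR
    calc (k : ℝ) ^ 2 * Real.log 2 ≤ (k : ℝ) ^ 2 * (G * c₂ ^ 2) := by gcongr
      _ = c₂ ^ 2 * (G * k ^ 2) := by ring
      _ ≤ c₂ ^ 2 * i := by gcongr
  have hi₁i₀ : i₁ ≤ i₀ := by
    calc i₁ ≤ L₀ := by omega
      _ = L₀ * 1 := (mul_one _).symm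
      _ ≤ L₀ * k ^ 2 := Nat.mul_le_mul_left _ (by nlinarith)
  exact oddAP_blocks_core (fun i hhi hε hc => hscale ε₁ τ i k h hε₁pos hε₁1 hk1 hkh4 hτh hhi hwin htyp hε hc)
    hδ hAterm hKterm hδτ2 hτδ (by omega) hhk.2.2 hgood_ε hgood_c hi₁i₀ hi₀n (by omega)

end Summit.QuantumAdvantage.DigitPolyUniformity.SketchLAR.KMT

end
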